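import Summits.RiemannHypothesis.RiemannHypothesis.Theorems.WeilFormatCMeanSquareGeneric
import HarnessLib

/-!
# Format C, L-C3b joint tail (design "TJ"), preliminaries: centred mean square and prime-sum moments

Route context: Fourier–Galerkin / Schur-complement certificates of Weil positivity on a window ("format C";
cell memo `run/shared/lean/pub/rh-explicit/rh-explicit-weil-10/FORMATC-DESIGN.md` §9.9.7; supporting
stmt-RiemannHypothesis-0098; seat rh-explicit-weil-10; lead ruling R8-15 (C)).  The structured part of an order-`J`
tail column is `X_m = (F_m/π)·P_A(m) + P_B(m)` with the mode function `F_m = π/4 + δ_m + S_m` (`|δ_m| ≤ c`, prime sum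
`S_m = Σ_k w_k sin(mθ_k)`) and two polynomials `P_A(m) = Σ_j α_j/m^{e^A_j}`, `P_B(m) = Σ_r β_r/m^{e^B_r}` in `1/m`.
The order-`J` files (`WeilFormatCTailEvenJ`, `…EvenJMS`) split `X_m²` between the two families by Peter–Paul
(`(1+η)`, `(1+η⁻¹)`).  Design "TJ" removes that split: centring the mode function at its mean `π/4`,
`X_m = Q(m) + t_m·P_A(m)` with ONE polynomial `Q = P_A/4 + P_B` over the joint exponent family and the small
perturbation `t_m = (δ_m + S_m)/π`, so that every term of `Σ_m X_m²` has an `N`-UNIFORM one-sided bound.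
This file (per-mode and oscillatory estimates):

* `sum_Ico_one_div_pow_le` — `Σ_{m∈Ico B₃ N} 1/m^E ≤ 1/((E−1)(B₃−1)^{E−1})`;
* `modeSqCentered_le` — `(δ + S)² ≤ c² + ½Σw² + 2cΣw + κ₂ + osc₂(x)` (pair resonances only; data `s₋, s₊`, `0` = crude);
* `abs_sum_Ico_oscPairs_div_pow_le` — `|Σ_m osc₂(m)/m^E| ≤ R₂/B₃^E`;
* `abs_sum_Ico_primeSum_div_pow_le` — `|Σ_m S_m/m^E| ≤ R₁/B₃^E + κ₁·hi(E)` (single frequencies; data `s₁`, `0` = crude).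

Standard axioms; no definitions; no RH claim.
-/

set_option autoImplicit false
-- `Summit.RiemannHypothesis.RiemannHypothesis.…` is the layout-mandated namespace (summit = problem name).
set_option linter.dupNamespace false

noncomputable section

open Finset
open scoped Real BigOperators

namespace Summit.RiemannHypothesis.RiemannHypothesis.Theorems.WeilFormatC

/-! ## A finite zeta tail -/

section Zeta

/-- `Σ_{m∈Ico B₃ N} 1/m^E ≤ 1/((E−1)(B₃−1)^{E−1})` for `2 ≤ E`, `2 ≤ B₃` (every `N`). -/
theorem sum_Ico_one_div_pow_le {E B₃ : ℕ} (hE : 2 ≤ E) (hB₃ : 2 ≤ B₃) (N : ℕ) :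
    ∑ m ∈ Finset.Ico B₃ N, 1 / (m : ℝ) ^ E ≤ 1 / ((E - 1 : ℕ) * (((B₃ - 1 : ℕ) : ℝ)) ^ (E - 1)) := by
  have hs := summable_one_div_add_pow hE B₃
  have h2 := tsum_one_div_add_pow_le hE hB₃
  have hcast : ((E : ℕ) : ℝ) - 1 = ((E - 1 : ℕ) : ℝ) := by
    rw [Nat.cast_sub (by omega), Nat.cast_one]
  rw [hcast] at h2
  calc ∑ m ∈ Finset.Ico B₃ N, 1 / (m : ℝ) ^ E = ∑ k ∈ Finset.range (N - B₃), 1 / ((B₃ : ℝ) + k) ^ E := by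
        rw [Finset.sum_Ico_eq_sum_range]
        refine Finset.sum_congr rfl fun k _ ↦ ?_
        push_cast
        ring
    _ ≤ ∑' k : ℕ, 1 / ((B₃ : ℝ) + k) ^ E := hs.sum_le_tsum _ fun k _ ↦ by positivity
    _ ≤ _ := h2

end Zeta

/-! ## The centred per-mode mean-square split -/

section Mode

/-- **Centred per-mode mean-square split.**  For `|δ| ≤ c`, `S = Σ_{k∈P} w_k sin(xθ_k)`, `w ≥ 0`, and ANY pair data
`s₋, s₊` (value `0` = crude frequency): `(δ + S)² ≤ [c² + ½Σw² + 2cΣw + κ₂] + osc₂(x)`, where `κ₂` collects the crude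
pair weights and `osc₂` the guarded pair cosines (the `s₁ ≡ 0` case of `modeSq_le`'s oscillatory part, without the
single-frequency term, which is absent from `S²`). -/
theorem modeSqCentered_le (P : Finset ℕ) (w θ : ℕ → ℝ) (hw : ∀ k, 0 ≤ w k) (x δ : ℝ) {c : ℝ} (hc : 0 ≤ c)
    (hδ : |δ| ≤ c) (sm sp : ℕ → ℕ → ℝ) :
    (δ + ∑ k ∈ P, w k * Real.sin (x * θ k)) ^ 2
      ≤ (c ^ 2 + (∑ k ∈ P, w k ^ 2) / 2 + 2 * c * (∑ k ∈ P, w k)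
          + ((∑ k ∈ P, ∑ k' ∈ P.erase k, if sm k k' = 0 then w k * w k' else 0) / 2
            + (∑ k ∈ P, ∑ k' ∈ P, if sp k k' = 0 then w k * w k' else 0) / 2))
        + ((∑ k ∈ P, ∑ k' ∈ P.erase k,
              (if sm k k' = 0 then (0 : ℝ) else 1) * (w k * w k') * Real.cos (x * (θ k - θ k'))) / 2
          - (∑ k ∈ P, ∑ k' ∈ P,
              (if sp k k' = 0 then (0 : ℝ) else 1) * (w k * w k') * Real.cos (x * (θ k + θ k'))) / 2) := by
  set S := ∑ k ∈ P, w k * Real.sin (x * θ k) with hS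
  set W1 := ∑ k ∈ P, w k with hW1
  set W2 := ∑ k ∈ P, w k ^ 2 with hW2
  -- |S| ≤ W1
  have hSm : |S| ≤ W1 := by
    rw [hS, hW1]
    refine (Finset.abs_sum_le_sum_abs _ _).trans (Finset.sum_le_sum fun k _ ↦ ?_)
    rw [abs_mul, abs_of_nonneg (hw k)]
    exact (mul_le_mul_of_nonneg_left (Real.abs_sin_le_one _) (hw k)).trans (le_of_eq (mul_one _))
  -- S² = W2/2 + (double cosine sums)
  have hS2 : S ^ 2 = W2 / 2 + ((∑ k ∈ P, ∑ k' ∈ P.erase k, w k * w k' * Real.cos (x * (θ k - θ k'))) / 2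
      - (∑ k ∈ P, ∑ k' ∈ P, w k * w k' * Real.cos (x * (θ k + θ k'))) / 2) := by
    rw [hS, hW2, sq_sum_sin_eq, sum_sum_eq_diag_add_offDiag P (fun k k' ↦ w k * w k' * Real.cos (x * (θ k - θ k')))]
    have hdiag : ∑ k ∈ P, w k * w k * Real.cos (x * (θ k - θ k)) = ∑ k ∈ P, w k ^ 2 :=
      Finset.sum_congr rfl fun k _ ↦ by rw [sub_self, mul_zero, Real.cos_zero, mul_one, sq]
    rw [hdiag]
    ring
  -- the centred smooth part
  have hδ2 : δ ^ 2 ≤ c ^ 2 := by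
    calc δ ^ 2 = |δ| ^ 2 := (sq_abs _).symm
      _ ≤ c ^ 2 := pow_le_pow_left₀ (abs_nonneg _) hδ 2
  have hδS : 2 * δ * S ≤ 2 * c * W1 := by
    have h2 : |2 * δ * S| ≤ 2 * c * W1 := by
      rw [abs_mul, abs_mul, abs_of_pos (by norm_num : (0 : ℝ) < 2)]
      exact mul_le_mul (mul_le_mul_of_nonneg_left hδ (by norm_num)) hSm (abs_nonneg _)
        (mul_nonneg (by norm_num) hc)
    linarith [(abs_le.mp h2).2]
  -- guarded / crude split of every pair frequency
  have hsplit : ((∑ k ∈ P, ∑ k' ∈ P.erase k, w k * w k' * Real.cos (x * (θ k - θ k'))) / 2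
        - (∑ k ∈ P, ∑ k' ∈ P, w k * w k' * Real.cos (x * (θ k + θ k'))) / 2)
      ≤ ((∑ k ∈ P, ∑ k' ∈ P.erase k, if sm k k' = 0 then w k * w k' else 0) / 2
            + (∑ k ∈ P, ∑ k' ∈ P, if sp k k' = 0 then w k * w k' else 0) / 2)
        + ((∑ k ∈ P, ∑ k' ∈ P.erase k,
              (if sm k k' = 0 then (0 : ℝ) else 1) * (w k * w k') * Real.cos (x * (θ k - θ k'))) / 2
          - (∑ k ∈ P, ∑ k' ∈ P,
              (if sp k k' = 0 then (0 : ℝ) else 1) * (w k * w k') * Real.cos (x * (θ k + θ k'))) / 2) := by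
    have e2 : ∀ k k', w k * w k' * Real.cos (x * (θ k - θ k'))
        ≤ (if sm k k' = 0 then (0 : ℝ) else 1) * (w k * w k') * Real.cos (x * (θ k - θ k'))
          + (if sm k k' = 0 then w k * w k' else 0) := by
      intro k k'
      split_ifs
      · have := mul_le_mul_of_nonneg_left (Real.cos_le_one (x * (θ k - θ k'))) (mul_nonneg (hw k) (hw k'))
        linarith
      · linarith
    have e3 : ∀ k k', -(w k * w k' * Real.cos (x * (θ k + θ k')))
        ≤ -((if sp k k' = 0 then (0 : ℝ) else 1) * (w k * w k') * Real.cos (x * (θ k + θ k')))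
          + (if sp k k' = 0 then w k * w k' else 0) := by
      intro k k'
      split_ifs
      · have := mul_le_mul_of_nonneg_left (Real.neg_one_le_cos (x * (θ k + θ k'))) (mul_nonneg (hw k) (hw k'))
        linarith
      · linarith
    have f2 : (∑ k ∈ P, ∑ k' ∈ P.erase k, w k * w k' * Real.cos (x * (θ k - θ k')))
        ≤ (∑ k ∈ P, ∑ k' ∈ P.erase k,
            (if sm k k' = 0 then (0 : ℝ) else 1) * (w k * w k') * Real.cos (x * (θ k - θ k')))
          + ∑ k ∈ P, ∑ k' ∈ P.erase k, (if sm k k' = 0 then w k * w k' else 0) := by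
      rw [← Finset.sum_add_distrib]
      refine Finset.sum_le_sum fun k _ ↦ ?_
      rw [← Finset.sum_add_distrib]
      exact Finset.sum_le_sum fun k' _ ↦ e2 k k'
    have f3 : -(∑ k ∈ P, ∑ k' ∈ P, w k * w k' * Real.cos (x * (θ k + θ k')))
        ≤ -(∑ k ∈ P, ∑ k' ∈ P, (if sp k k' = 0 then (0 : ℝ) else 1) * (w k * w k') * Real.cos (x * (θ k + θ k')))
          + ∑ k ∈ P, ∑ k' ∈ P, (if sp k k' = 0 then w k * w k' else 0) := by
      rw [← Finset.sum_neg_distrib, ← Finset.sum_neg_distrib, ← Finset.sum_add_distrib]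
      refine Finset.sum_le_sum fun k _ ↦ ?_
      rw [← Finset.sum_neg_distrib, ← Finset.sum_neg_distrib, ← Finset.sum_add_distrib]
      exact Finset.sum_le_sum fun k' _ ↦ e3 k k'
    linarith [f2, f3]
  have e2 : (δ + S) ^ 2 = δ ^ 2 + 2 * δ * S + S ^ 2 := by ring
  rw [e2, hS2]
  linarith [hδ2, hδS, hsplit]

end Mode

/-! ## Oscillatory sums against the inverse powers -/

section Osc

/-- **The pair-oscillation Gram entry.**  `|Σ_{m∈Ico B₃ N} osc₂(m)/m^E| ≤ R₂/B₃^E`,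
`R₂ = ½Σ_kΣ_{k'≠k} w_kw_{k'}/s₋(k,k') + ½Σ_{k,k'} w_kw_{k'}/s₊(k,k')` (`x/0 = 0`), given `0 ≤ s ≤ |sin(φ/2)|` at
every pair frequency of non-zero weight. -/
theorem abs_sum_Ico_oscPairs_div_pow_le (P : Finset ℕ) (w θ : ℕ → ℝ) (hw : ∀ k, 0 ≤ w k)
    (sm sp : ℕ → ℕ → ℝ)
    (hsm : ∀ k ∈ P, ∀ k' ∈ P, k ≠ k' → w k * w k' = 0 ∨ (0 ≤ sm k k' ∧ sm k k' ≤ |Real.sin ((θ k - θ k') / 2)|))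
    (hsp : ∀ k ∈ P, ∀ k' ∈ P, w k * w k' = 0 ∨ (0 ≤ sp k k' ∧ sp k k' ≤ |Real.sin ((θ k + θ k') / 2)|))
    {B₃ : ℕ} (hB₃ : 1 ≤ B₃) (E N : ℕ) :
    |∑ m ∈ Finset.Ico B₃ N,
        ((∑ k ∈ P, ∑ k' ∈ P.erase k,
              (if sm k k' = 0 then (0 : ℝ) else 1) * (w k * w k') * Real.cos ((m : ℝ) * (θ k - θ k'))) / 2
          - (∑ k ∈ P, ∑ k' ∈ P,
              (if sp k k' = 0 then (0 : ℝ) else 1) * (w k * w k') * Real.cos ((m : ℝ) * (θ k + θ k'))) / 2)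
        * (1 / (m : ℝ) ^ E)|
      ≤ ((∑ k ∈ P, ∑ k' ∈ P.erase k, w k * w k' / sm k k') / 2
          + (∑ k ∈ P, ∑ k' ∈ P, w k * w k' / sp k k') / 2) / (B₃ : ℝ) ^ E := by
  have h := abs_sum_Ico_osc_div_pow_le P w θ hw (fun _ ↦ 0) sm sp
    (fun k _ ↦ Or.inr ⟨le_rfl, abs_nonneg _⟩) hsm hsp hB₃ E N
  simp only [if_true, zero_mul, Finset.sum_const_zero, mul_zero, zero_add, div_zero] at h
  exact h

/-- **The single-frequency prime sum against the inverse powers.**  With `S_m = Σ_{k∈P} w_k sin(mθ_k)`, `w ≥ 0`,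
data `s₁` (`0 ≤ s₁ ≤ |sin(θ_k/2)|` wherever `w_k ≠ 0`; the value `0` = crude), `2 ≤ E`, `2 ≤ B₃`, every `N`:
`|Σ_{m∈Ico B₃ N} S_m/m^E| ≤ (Σ_k w_k/s₁(k))/B₃^E + (Σ_{k crude} w_k)·1/((E−1)(B₃−1)^{E−1})` (`x/0 = 0`). -/
theorem abs_sum_Ico_primeSum_div_pow_le (P : Finset ℕ) (w θ : ℕ → ℝ) (hw : ∀ k, 0 ≤ w k) (s₁ : ℕ → ℝ)
    (hs₁ : ∀ k ∈ P, w k = 0 ∨ (0 ≤ s₁ k ∧ s₁ k ≤ |Real.sin (θ k / 2)|))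
    {B₃ E : ℕ} (hB₃ : 2 ≤ B₃) (hE : 2 ≤ E) (N : ℕ) :
    |∑ m ∈ Finset.Ico B₃ N, (∑ k ∈ P, w k * Real.sin ((m : ℝ) * θ k)) * (1 / (m : ℝ) ^ E)|
      ≤ (∑ k ∈ P, w k / s₁ k) / (B₃ : ℝ) ^ E
        + (∑ k ∈ P, if s₁ k = 0 then w k else 0) * (1 / ((E - 1 : ℕ) * (((B₃ - 1 : ℕ) : ℝ)) ^ (E - 1))) := by
  set T := Finset.Ico B₃ N with hT
  set g : ℕ → ℝ := fun m ↦ 1 / (m : ℝ) ^ E with hg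
  set χ : ℕ → ℝ := fun k ↦ if s₁ k = 0 then (0 : ℝ) else 1 with hχ
  set w' : ℕ → ℝ := fun k ↦ if s₁ k = 0 then w k else 0 with hw'
  have hsplitw : ∀ k, w k = χ k * w k + w' k := fun k ↦ by
    simp only [hχ, hw']; split_ifs <;> ring
  have hg0 : ∀ m, 0 ≤ g m := fun m ↦ by simp only [hg]; positivity
  have hH := sum_Ico_one_div_pow_le hE hB₃ N
  -- exchange the order of summation
  have hexp0 : ∑ m ∈ T, (∑ k ∈ P, w k * Real.sin ((m : ℝ) * θ k)) * g m
      = ∑ k ∈ P, w k * ∑ m ∈ T, g m * Real.sin ((m : ℝ) * θ k) := by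
    simp only [Finset.sum_mul, Finset.mul_sum]
    rw [Finset.sum_comm]
    exact Finset.sum_congr rfl fun k _ ↦ Finset.sum_congr rfl fun m _ ↦ by ring
  have hexp : ∑ m ∈ T, (∑ k ∈ P, w k * Real.sin ((m : ℝ) * θ k)) * g m
      = ∑ k ∈ P, (χ k * w k * ∑ m ∈ T, g m * Real.sin ((m : ℝ) * θ k)
          + w' k * ∑ m ∈ T, g m * Real.sin ((m : ℝ) * θ k)) := by
    rw [hexp0]
    refine Finset.sum_congr rfl fun k _ ↦ ?_
    have hk := hsplitw k
    calc w k * ∑ m ∈ T, g m * Real.sin ((m : ℝ) * θ k)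
        = (χ k * w k + w' k) * ∑ m ∈ T, g m * Real.sin ((m : ℝ) * θ k) := by rw [← hk]
      _ = _ := by ring
  rw [hexp]
  refine (Finset.abs_sum_le_sum_abs _ _).trans ?_
  have hterm : ∀ k ∈ P, |χ k * w k * ∑ m ∈ T, g m * Real.sin ((m : ℝ) * θ k)
      + w' k * ∑ m ∈ T, g m * Real.sin ((m : ℝ) * θ k)|
      ≤ w k / s₁ k * (1 / (B₃ : ℝ) ^ E) + w' k * (1 / ((E - 1 : ℕ) * (((B₃ - 1 : ℕ) : ℝ)) ^ (E - 1))) := by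
    intro k hk
    refine (abs_add_le _ _).trans (add_le_add ?_ ?_)
    · have h := (abs_guard_mul_sum_Ico_trig_le (φ := θ k) (hw k) (hs₁ k hk) (by omega : 1 ≤ B₃) E N).2
      simpa only [hχ, hg, hT, mul_assoc] using h
    · have hw'0 : 0 ≤ w' k := by simp only [hw']; split_ifs; exacts [hw k, le_rfl]
      rw [abs_mul, abs_of_nonneg hw'0]
      refine mul_le_mul_of_nonneg_left ?_ hw'0
      refine (Finset.abs_sum_le_sum_abs _ _).trans ?_
      refine le_trans (Finset.sum_le_sum fun m _ ↦ ?_) hH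
      rw [abs_mul, abs_of_nonneg (hg0 m), hg]
      exact (mul_le_mul_of_nonneg_left (Real.abs_sin_le_one _) (hg0 m)).trans (le_of_eq (mul_one _))
  refine (Finset.sum_le_sum hterm).trans (le_of_eq ?_)
  rw [Finset.sum_add_distrib, ← Finset.sum_mul, ← Finset.sum_mul]
  simp only [hw']
  ring

end Osc

end Summit.RiemannHypothesis.RiemannHypothesis.Theorems.WeilFormatC

end
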